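import Literature.InformationTheory.QuantumCodes.QuantumExpanderThresholdMinMax
import Literature.InformationTheory.QuantumCodes.SmallSetFlipFailureSharp
import HarnessLib

/-!
# FGL18 Theorem 1 for quantum expander codes with the PRINTED constants: the threshold VALUE `p_ls` (and the
# independent-noise form)

Index of sources: `[cite: FawziGrospellierLeverrier2018]` = Fawzi–Grospellier–Leverrier, STOC 2018 / arXiv:1711.08351v2:
Thm 1 (§1 p0004), its proof (end of §4, p0014 L1-16: "We let `p₀ = p_ls` as defined in (pls) where `𝒢` is the
adjacency graph of the quantum expander code … `t = t_SSF(β) = Ω(√n)` … `E` is corrected except with probability at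
most `C n (p/p₀)^{αt}`"), Thm 17 (§4 p0013).

qec PARTITION v2 row 04 (`prover-qec-type-04`, gen 5), follow-on (e) to items 04.IID / 04.FGL1x. The tree's
`QuantumExpander.fgl18_theorem1_minmax` proves Theorem 1 in its `∃ p₀ C C'` form with the cruder threshold
`p₀ = (4Δ²)^{-1/α}` of the Peierls-type cluster bound. Here the same assembly (Remark 9 domination →
Prop 11 on runs → locality/percolation reduction → the adjacency graph `checkGraph (fromRows H_X H_Z)` of degree
`≤ Δ_𝒢 := 2·max(Δ_A,Δ_B)·(Δ_A+Δ_B)`) is closed with the SHARP percolation bounds of `SmallSetFlipFailureSharp.lean`,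
giving every constant explicitly and as printed:

* `fgl18_theorem1_sharp` — local stochastic noise of parameter `0 < p < p_ls(Δ_𝒢, α)`, `α = β̃/(1+β̃)`
  (`β̃ = betaZero (min Δ) (max Δ) δ_A δ_B`): for every `κ ≤ β̃·max Δ` and every small-set-flip decoder,
  `Σ_{E not corrected} μ(E) ≤ C(p)·(n_A² + n_B²)·(p/p_ls)^{α(⌊t₀⌋+1)}`, with
  `t₀ = (min Δ/max Δ)·(β̃/(1+β̃))·min(γ_A n_A, γ_B n_B)` (the radius of Prop 11) and
  `1/C(p) = (1 − e^{h(α)/α} p)(1 − (p/p_ls)^α)` (Thm 17's constant);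
* `fgl18_theorem1_iid` — independent noise `bernoulliWeight p` with `0 < p < α/(Δ_𝒢 − 1)` and `q < 1`:
  `≤ (n_A² + n_B²)·((Δ_𝒢−1)/(Δ_𝒢−2))²·q^{⌊t₀⌋+1}/(1−q)`, `q = (1-p)^{Δ_𝒢-1-α} p^α e^{h(α)} (Δ_𝒢-1)(1+1/(Δ_𝒢-2))^{Δ_𝒢-2}`
  (eq. (probiid)).

The degree bound `Δ_𝒢` is the tree's (`degree_checkGraph_fromRows_le_max`, weakened by one); the paper's adjacency
graph and its bound `d_B² + 2d_B(d_A − 1)` are a different bookkeeping of the same code, so the NUMBER `p_ls(Δ_𝒢, α)`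
is ours ("constants labelled ours where the Δ-convention differs", qec T-50). All statements PROVED (kernel axioms);
no definitions, no named facts.
-/

namespace Literature.InformationTheory.QuantumCodes

namespace QuantumExpander

open Finset Matrix Literature.Probability.LatticeModels

/-! ### The common reduction: hypotheses of the generic failure bounds for `Q_G` -/

section Sharp

variable {A B : Type} [Fintype A] [Fintype B] [DecidableEq A] [DecidableEq B]

open Classical in
/-- **FGL18 Theorem 1 with the printed threshold value (local stochastic noise).** For a `(Δ_A,Δ_B)`-biregular
`(γ_A,δ_A,γ_B,δ_B)`-expanding `G` with `β̃ = betaZero (min Δ) (max Δ) δ_A δ_B > 0`, every `κ ≤ β̃·max(Δ_A,Δ_B)`, every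
small-set-flip decoder `D` of parameter `κ` (syndromes `expanderHX H`, flips in the rows of `expanderHZ H`) and every
locally stochastic weight of parameter `0 < p < p_ls(Δ_𝒢, α)`, `α = β̃/(1+β̃)`, `Δ_𝒢 = 2·max(Δ_A,Δ_B)·(Δ_A+Δ_B)`:
`Σ_{E not corrected} μ(E) ≤ C(p)·(n_A² + n_B²)·(p/p_ls)^{α(⌊t₀⌋+1)}`,
`t₀ = (min Δ/max Δ)(β̃/(1+β̃))·min(γ_A n_A, γ_B n_B)`, `1/C(p) = (1 − e^{h(α)/α}p)(1 − (p/p_ls)^α)` — "We let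
`p₀ = p_ls` … where `𝒢` is the adjacency graph of the quantum expander code … `E` is corrected except with
probability at most `C n (p/p₀)^{αt}`". [cite: FawziGrospellierLeverrier2018, proof of Thm 1 (end of §4, arXiv v2 p0014 L1-16) with Thm 17 eq. (problc)] -/
theorem fgl18_theorem1_sharp (H : Matrix B A (ZMod 2)) {dA dB : ℕ} {γA δA γB δB : ℝ}
    (hreg : IsBiregular H dA dB) (hexp : IsLeftRightExpanding H dA dB γA δA γB δB)
    (hdA : 0 < dA) (hdB : 0 < dB) (hγA : 0 < γA) (hδA : 0 < δA) (hγB : 0 < γB) (hδB : 0 < δB)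
    (hβ : 0 < betaZero (min dA dB) (max dA dB) δA δB)
    {κ : ℝ} (hκ : κ ≤ betaZero (min dA dB) (max dA dB) δA δB * ((max dA dB : ℕ) : ℝ))
    {D : Decoder (A × B → ZMod 2) ((A × A) ⊕ (B × B) → ZMod 2)}
    (hD : IsSSFDecoder κ (expanderHX H) (expanderHZ H) D)
    {p : ℝ} {μ : Finset ((A × A) ⊕ (B × B)) → ℝ} (hμ : IsLocallyStochastic μ p) (hp0 : 0 < p)
    (hp : p < percolationValue (2 * max dA dB * (dA + dB))
      (betaZero (min dA dB) (max dA dB) δA δB / (1 + betaZero (min dA dB) (max dA dB) δA δB))) :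
    (∑ E ∈ univ.filter (fun E : Finset ((A × A) ⊕ (B × B)) =>
        ¬ D.Corrects (fun x => expanderHX H *ᵥ x) (rowSpace (expanderHZ H) : Set _) (flipVec E)), μ E)
      ≤ (1 / ((1 - Real.exp (Real.binEntropy
                  (betaZero (min dA dB) (max dA dB) δA δB / (1 + betaZero (min dA dB) (max dA dB) δA δB)) /
                (betaZero (min dA dB) (max dA dB) δA δB / (1 + betaZero (min dA dB) (max dA dB) δA δB))) * p) *
              (1 - (p / percolationValue (2 * max dA dB * (dA + dB))
                (betaZero (min dA dB) (max dA dB) δA δB / (1 + betaZero (min dA dB) (max dA dB) δA δB))) ^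
                  (betaZero (min dA dB) (max dA dB) δA δB / (1 + betaZero (min dA dB) (max dA dB) δA δB))))) *
        ((Fintype.card A : ℝ) ^ 2 + (Fintype.card B : ℝ) ^ 2) *
        (p / percolationValue (2 * max dA dB * (dA + dB))
            (betaZero (min dA dB) (max dA dB) δA δB / (1 + betaZero (min dA dB) (max dA dB) δA δB))) ^
          ((betaZero (min dA dB) (max dA dB) δA δB / (1 + betaZero (min dA dB) (max dA dB) δA δB)) *
            ((⌊((min dA dB : ℕ) : ℝ) / ((max dA dB : ℕ) : ℝ) * betaZero (min dA dB) (max dA dB) δA δB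
                / (1 + betaZero (min dA dB) (max dA dB) δA δB) * min (γA * Fintype.card A) (γB * Fintype.card B)⌋₊
                + 1 : ℕ) : ℝ)) := by
  classical
  -- names
  set dM : ℕ := max dA dB with hdMdef
  set β : ℝ := betaZero (min dA dB) (max dA dB) δA δB with hβdef
  set κ₀ : ℝ := β * dM with hκ₀def
  set t₀ : ℝ := ((min dA dB : ℕ) : ℝ) / ((max dA dB : ℕ) : ℝ) * β / (1 + β) *
    min (γA * Fintype.card A) (γB * Fintype.card B) with ht₀def
  have hdM0 : 0 < dM := lt_max_of_lt_left hdA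
  have hdM' : (0 : ℝ) < dM := by exact_mod_cast hdM0
  have hκ₀pos : 0 < κ₀ := mul_pos hβ hdM'
  have hα : κ₀ / (κ₀ + dM) = β / (1 + β) := by
    rw [hκ₀def]
    field_simp
    ring
  -- Remark 9: dominate the `κ`-decoder by a `κ₀`-decoder
  obtain ⟨D₀, hD₀, hdom⟩ := SmallSetFlip.exists_dominating_sum_le hκ
    (fun _ hv => expanderHX_mulVec_eq_zero_of_mem_rowSpace H hv) hD (fun E => hμ.nonneg E)
  refine hdom.trans ?_
  -- the adjacency graph and the hypotheses of the generic reduction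
  set G := checkGraph (Matrix.fromRows (expanderHX H) (expanderHZ H)) with hGdef
  have hGX : ∀ c q q', q ≠ q' → expanderHX H c q ≠ 0 → expanderHX H c q' ≠ 0 → G.Adj q q' :=
    fun c q q' hne h1 h2 => checkGraph_fromRows_adj_of_X H c q q' hne h1 h2
  have hGZ : ∀ g q q', q ≠ q' → expanderHZ H g q ≠ 0 → expanderHZ H g q' ≠ 0 → G.Adj q q' :=
    fun g q q' hne h1 h2 => checkGraph_fromRows_adj_of_Z H g q q' hne h1 h2
  have hw : ∀ v : (A × A) ⊕ (B × B) → ZMod 2,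
      (hammingNorm (expanderHX H *ᵥ v) : ℝ) ≤ (dM : ℝ) * hammingNorm v := fun v => by
    rw [hdMdef]; exact_mod_cast hammingNorm_expanderHX_mulVec_le_max H hreg v
  have ht₀ : 0 ≤ t₀ := by
    rw [ht₀def]
    have : 0 ≤ min (γA * Fintype.card A) (γB * Fintype.card B) :=
      le_min (mul_nonneg hγA.le (Nat.cast_nonneg _)) (mul_nonneg hγB.le (Nat.cast_nonneg _))
    have hb : 0 ≤ β / (1 + β) := div_nonneg hβ.le (by linarith)
    have : 0 ≤ ((min dA dB : ℕ) : ℝ) / ((max dA dB : ℕ) : ℝ) * β / (1 + β) := by positivity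
    positivity
  have hcorr : ∀ (E' : Finset ((A × A) ⊕ (B × B))) (l' : List (Finset ((A × A) ⊕ (B × B)))),
      IsSSFRun κ₀ (expanderHX H) (expanderHZ H) (expanderHX H *ᵥ flipVec E') l' →
      ((E'.card : ℝ) ≤ t₀) → flipVec E' + runOutput l' ∈ rowSpace (expanderHZ H) := by
    intro E' l' hrun hE'
    have hrun' : IsSSFRun (betaZero (min dA dB) (max dA dB) δA δB * ((max dA dB : ℕ) : ℝ))
        (expanderHX H) (expanderHZ H) (expanderHX H *ᵥ flipVec E') l' := by
      rw [← hdMdef, ← hβdef, ← hκ₀def]; exact hrun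
    refine add_runOutput_mem_rowSpace_minmax H hreg hexp hdA hdB hδA hδB (by rw [← hβdef]; exact hβ) hrun' ?_
    rw [hammingNorm_flipVec, ← hβdef]
    exact hE'.trans_eq (by rw [ht₀def])
  have hdeg : ∀ x, G.degree x ≤ 2 * dM * (dA + dB) := by
    intro x
    refine (degree_checkGraph_fromRows_le_max H hreg x).trans ?_
    rw [hdMdef]
    exact Nat.mul_le_mul_left _ (Nat.sub_le _ _)
  have hd3 : 3 ≤ 2 * dM * (dA + dB) := by
    have : 1 ≤ dM := hdM0
    nlinarith
  -- the sharp generic bound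
  have hp' : p < percolationValue (2 * dM * (dA + dB)) (κ₀ / (κ₀ + dM)) := by
    rw [hα]; exact hp
  have key := SmallSetFlip.sum_not_corrects_le_sharp (G := G) hGX hGZ hκ₀pos hdM'.le hw ht₀ hcorr hD₀ hd3 hdeg
    hμ hp0 hp'
  rw [hα, card_qubits] at key
  exact_mod_cast key

open Classical in
/-- **FGL18 Theorem 1 under INDEPENDENT noise, with the eq. (probiid) constant.** Same code and decoders; error sets
drawn from `bernoulliWeight p` with `0 < p < α/(Δ_𝒢 − 1)` and
`q = (1-p)^{Δ_𝒢-1-α} p^α e^{h(α)} (Δ_𝒢-1)(1+1/(Δ_𝒢-2))^{Δ_𝒢-2} < 1` (`α = β̃/(1+β̃)`, `Δ_𝒢 = 2·max(Δ_A,Δ_B)·(Δ_A+Δ_B)`):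
`Σ_{E not corrected} p^|E|(1-p)^{N-|E|} ≤ (n_A²+n_B²)·((Δ_𝒢−1)/(Δ_𝒢−2))²·q^{⌊t₀⌋+1}/(1−q)` ("in the independent error
model"). [cite: FawziGrospellierLeverrier2018, Thm 1 (§1, arXiv v2 p0004: "in the independent error model, and also in the local stochastic error model") with Thm 17 eq. (probiid)] -/
theorem fgl18_theorem1_iid (H : Matrix B A (ZMod 2)) {dA dB : ℕ} {γA δA γB δB : ℝ}
    (hreg : IsBiregular H dA dB) (hexp : IsLeftRightExpanding H dA dB γA δA γB δB)
    (hdA : 0 < dA) (hdB : 0 < dB) (hγA : 0 < γA) (hδA : 0 < δA) (hγB : 0 < γB) (hδB : 0 < δB)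
    (hβ : 0 < betaZero (min dA dB) (max dA dB) δA δB)
    {κ : ℝ} (hκ : κ ≤ betaZero (min dA dB) (max dA dB) δA δB * ((max dA dB : ℕ) : ℝ))
    {D : Decoder (A × B → ZMod 2) ((A × A) ⊕ (B × B) → ZMod 2)}
    (hD : IsSSFDecoder κ (expanderHX H) (expanderHZ H) D)
    {p : ℝ} (hp0 : 0 < p)
    (hpα : p < (betaZero (min dA dB) (max dA dB) δA δB / (1 + betaZero (min dA dB) (max dA dB) δA δB)) / ((((2 * max dA dB * (dA + dB) : ℕ) : ℝ)) - 1))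
    (hq : ((1 - p) ^ ((((2 * max dA dB * (dA + dB) : ℕ) : ℝ)) - 1 - (betaZero (min dA dB) (max dA dB) δA δB / (1 + betaZero (min dA dB) (max dA dB) δA δB))) * p ^ (betaZero (min dA dB) (max dA dB) δA δB / (1 + betaZero (min dA dB) (max dA dB) δA δB)) * Real.exp (Real.binEntropy (betaZero (min dA dB) (max dA dB) δA δB / (1 + betaZero (min dA dB) (max dA dB) δA δB)))
          * (((((2 * max dA dB * (dA + dB) : ℕ) : ℝ)) - 1) * (1 + 1 / ((((2 * max dA dB * (dA + dB) : ℕ) : ℝ)) - 2)) ^ (2 * max dA dB * (dA + dB) - 2))) < 1) :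
    (∑ E ∈ univ.filter (fun E : Finset ((A × A) ⊕ (B × B)) =>
        ¬ D.Corrects (fun x => expanderHX H *ᵥ x) (rowSpace (expanderHZ H) : Set _) (flipVec E)),
        bernoulliWeight p E)
      ≤ ((Fintype.card A : ℝ) ^ 2 + (Fintype.card B : ℝ) ^ 2) * (((((2 * max dA dB * (dA + dB) : ℕ) : ℝ)) - 1) / ((((2 * max dA dB * (dA + dB) : ℕ) : ℝ)) - 2)) ^ 2 *
        (((1 - p) ^ ((((2 * max dA dB * (dA + dB) : ℕ) : ℝ)) - 1 - (betaZero (min dA dB) (max dA dB) δA δB / (1 + betaZero (min dA dB) (max dA dB) δA δB))) * p ^ (betaZero (min dA dB) (max dA dB) δA δB / (1 + betaZero (min dA dB) (max dA dB) δA δB)) * Real.exp (Real.binEntropy (betaZero (min dA dB) (max dA dB) δA δB / (1 + betaZero (min dA dB) (max dA dB) δA δB)))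
          * (((((2 * max dA dB * (dA + dB) : ℕ) : ℝ)) - 1) * (1 + 1 / ((((2 * max dA dB * (dA + dB) : ℕ) : ℝ)) - 2)) ^ (2 * max dA dB * (dA + dB) - 2))) ^ (⌊((min dA dB : ℕ) : ℝ) / ((max dA dB : ℕ) : ℝ) * betaZero (min dA dB) (max dA dB) δA δB
              / (1 + betaZero (min dA dB) (max dA dB) δA δB) * min (γA * Fintype.card A) (γB * Fintype.card B)⌋₊ + 1)
          / (1 - ((1 - p) ^ ((((2 * max dA dB * (dA + dB) : ℕ) : ℝ)) - 1 - (betaZero (min dA dB) (max dA dB) δA δB / (1 + betaZero (min dA dB) (max dA dB) δA δB))) * p ^ (betaZero (min dA dB) (max dA dB) δA δB / (1 + betaZero (min dA dB) (max dA dB) δA δB)) * Real.exp (Real.binEntropy (betaZero (min dA dB) (max dA dB) δA δB / (1 + betaZero (min dA dB) (max dA dB) δA δB)))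
          * (((((2 * max dA dB * (dA + dB) : ℕ) : ℝ)) - 1) * (1 + 1 / ((((2 * max dA dB * (dA + dB) : ℕ) : ℝ)) - 2)) ^ (2 * max dA dB * (dA + dB) - 2))))) := by
  classical
  set dM : ℕ := max dA dB with hdMdef
  set β : ℝ := betaZero (min dA dB) (max dA dB) δA δB with hβdef
  set κ₀ : ℝ := β * dM with hκ₀def
  set t₀ : ℝ := ((min dA dB : ℕ) : ℝ) / ((max dA dB : ℕ) : ℝ) * β / (1 + β) *
    min (γA * Fintype.card A) (γB * Fintype.card B) with ht₀def
  have hdM0 : 0 < dM := lt_max_of_lt_left hdA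
  have hdM' : (0 : ℝ) < dM := by exact_mod_cast hdM0
  have hκ₀pos : 0 < κ₀ := mul_pos hβ hdM'
  have hα : κ₀ / (κ₀ + dM) = β / (1 + β) := by
    rw [hκ₀def]
    field_simp
    ring
  have hp1 : p ≤ 1 := by
    have hd3' : (3 : ℝ) ≤ ((2 * dM * (dA + dB) : ℕ) : ℝ) := by
      have : 3 ≤ 2 * dM * (dA + dB) := by have : 1 ≤ dM := hdM0; nlinarith
      exact_mod_cast this
    have hb1 : β / (1 + β) ≤ 1 := by rw [div_le_one (by linarith)]; linarith
    have h1 : β / (1 + β) / (((2 * dM * (dA + dB) : ℕ) : ℝ) - 1) ≤ 1 / 2 := by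
      rw [div_le_iff₀ (by linarith)]; linarith
    linarith [hpα, h1]
  obtain ⟨D₀, hD₀, hdom⟩ := SmallSetFlip.exists_dominating_sum_le hκ
    (fun _ hv => expanderHX_mulVec_eq_zero_of_mem_rowSpace H hv) hD
    (fun E => bernoulliWeight_nonneg hp0.le hp1 E)
  refine hdom.trans ?_
  set G := checkGraph (Matrix.fromRows (expanderHX H) (expanderHZ H)) with hGdef
  have hGX : ∀ c q q', q ≠ q' → expanderHX H c q ≠ 0 → expanderHX H c q' ≠ 0 → G.Adj q q' :=
    fun c q q' hne h1 h2 => checkGraph_fromRows_adj_of_X H c q q' hne h1 h2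
  have hGZ : ∀ g q q', q ≠ q' → expanderHZ H g q ≠ 0 → expanderHZ H g q' ≠ 0 → G.Adj q q' :=
    fun g q q' hne h1 h2 => checkGraph_fromRows_adj_of_Z H g q q' hne h1 h2
  have hw : ∀ v : (A × A) ⊕ (B × B) → ZMod 2,
      (hammingNorm (expanderHX H *ᵥ v) : ℝ) ≤ (dM : ℝ) * hammingNorm v := fun v => by
    rw [hdMdef]; exact_mod_cast hammingNorm_expanderHX_mulVec_le_max H hreg v
  have ht₀ : 0 ≤ t₀ := by
    rw [ht₀def]
    have : 0 ≤ min (γA * Fintype.card A) (γB * Fintype.card B) :=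
      le_min (mul_nonneg hγA.le (Nat.cast_nonneg _)) (mul_nonneg hγB.le (Nat.cast_nonneg _))
    have : 0 ≤ ((min dA dB : ℕ) : ℝ) / ((max dA dB : ℕ) : ℝ) * β / (1 + β) := by
      have hb : 0 ≤ 1 + β := by linarith
      positivity
    positivity
  have hcorr : ∀ (E' : Finset ((A × A) ⊕ (B × B))) (l' : List (Finset ((A × A) ⊕ (B × B)))),
      IsSSFRun κ₀ (expanderHX H) (expanderHZ H) (expanderHX H *ᵥ flipVec E') l' →
      ((E'.card : ℝ) ≤ t₀) → flipVec E' + runOutput l' ∈ rowSpace (expanderHZ H) := by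
    intro E' l' hrun hE'
    have hrun' : IsSSFRun (betaZero (min dA dB) (max dA dB) δA δB * ((max dA dB : ℕ) : ℝ))
        (expanderHX H) (expanderHZ H) (expanderHX H *ᵥ flipVec E') l' := by
      rw [← hdMdef, ← hβdef, ← hκ₀def]; exact hrun
    refine add_runOutput_mem_rowSpace_minmax H hreg hexp hdA hdB hδA hδB (by rw [← hβdef]; exact hβ) hrun' ?_
    rw [hammingNorm_flipVec, ← hβdef]
    exact hE'.trans_eq (by rw [ht₀def])
  have hdeg : ∀ x, G.degree x ≤ 2 * dM * (dA + dB) := by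
    intro x
    refine (degree_checkGraph_fromRows_le_max H hreg x).trans ?_
    rw [hdMdef]
    exact Nat.mul_le_mul_left _ (Nat.sub_le _ _)
  have hd3 : 3 ≤ 2 * dM * (dA + dB) := by
    have : 1 ≤ dM := hdM0
    nlinarith
  have hpα' : p < (κ₀ / (κ₀ + dM)) / (((2 * dM * (dA + dB) : ℕ) : ℝ) - 1) := by
    rw [hα]; exact hpα
  have hq' := hq
  rw [← hα] at hq'
  have key := SmallSetFlip.sum_not_corrects_bernoulli_le (G := G) hGX hGZ hκ₀pos hdM'.le hw ht₀ hcorr hD₀ hd3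
    hdeg hp0 hpα' hq'
  rw [hα, card_qubits] at key
  exact_mod_cast key

end Sharp

end QuantumExpander

end Literature.InformationTheory.QuantumCodes
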